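import Summits.CriticalPhenomena.CardyFormulaZ2.Theorems.CardyIKTransportIKLinearTransportStubCutMarkovKernelGraph
import Literature.Probability.LatticeModels.SquareTilingConjugate

/-!
# Stub `stub_CutMarkovKernel` (K) — part C: FACTORISATION OF THE STRIP DIAGRAM ACROSS A CUT ROW

Support file (`--supports stmt-CriticalPhenomena-5076`, registered sub-goal `cmk_stripDiagram_eq_comb`).

The combinatorial heart of the cut-Markov property (K). For a configuration `x` and a row `c`:

* `cmk_isCut_iff_cutLoc` — `c` is a cut row of the pinned statistic of `x` (`IsCut`, read from the
  environment and the strip diagram) IFF the LOCAL-ONE-SIDED conditions `cmkCutLoc i c x` hold: the boundary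
  pattern, `(i,c) ≁ (i+2,c)` inside the lower half-strip and inside the upper half-strip, `(i,c-2) ∼ pivot`
  inside the lower half-strip and `pivot ∼ (i,c+2)` inside the upper one (pivot = the middle cell `(i+1,c)`),
  the upper conditions being read on `cmkFlat i c x` — `x` with the two row-`c` face flags set — so that they
  do not read the row-`c` flags (those faces are bichromatic at a cut). (`⟹`: rerouting `isCut_reroute`;
  `⟸`: the excursion lemma `cmk_excursion`.)
* `cmk_stripDiagram_eq_comb` (registered) — AT A CUT ROW THE STRIP DIAGRAM IS ASSEMBLED from the lower
  half-strip reachability `cmkLoR i c x` and the upper half-diagram with pivot `cmkUpDp i c x`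
  (`cmkComb`: lower pairs, upper pairs, and straddling pairs through a row-`c` cell).
* `cmk_pi2_stripDiagram` — conversely the upper half-diagram with pivot is READ OFF the strip diagram
  (`cmkPi2`: upper boundary pairs, and `pivot ∼ Q` iff `((i,c-2), Q) ∈ Δ`).
-/

noncomputable section

namespace Summit.CriticalPhenomena.CardyFormulaZ2.Theorems.IKLinearTransport.PinnedDiagramExchange

open scoped Classical MeasureTheory ENNReal symmDiff
open Set MeasureTheory
open Literature.Probability.Percolation Literature.Probability.LatticeModels

/-! ## Vocabulary -/

/-- Boundary cells of the strip. [folklore] -/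
def cmkBd (i : ℤ) (P : Site 2) : Prop := P 0 = i ∨ P 0 = i + 2

/-- Boundary cells or the pivot `(i+1, c)`. [folklore] -/
def cmkBdp (i c : ℤ) (P : Site 2) : Prop := cmkBd i P ∨ P = ![i + 1, c]

/-- The boundary pattern of a cut row, read on the configuration. [folklore] -/
def cmkPattern (i c : ℤ) (x : Obs) : Prop :=
  (∀ y : ℤ, c - 1 ≤ y → y ≤ c + 1 →
    (((![i, y] : Site 2) ∈ x.1 ↔ (![i, c] : Site 2) ∈ x.1) ∧ ((![i + 2, y] : Site 2) ∈ x.1 ↔ (![i, c] : Site 2) ∈ x.1))) ∧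
  ((![i, c - 2] : Site 2) ∈ x.1 ↔ (![i, c] : Site 2) ∉ x.1) ∧ ((![i, c + 2] : Site 2) ∈ x.1 ↔ (![i, c] : Site 2) ∉ x.1)

/-- The configuration with the two row-`c` face flags set. [folklore] -/
def cmkFlat (i c : ℤ) (x : Obs) : Obs := (x.1, {f | f ∈ x.2 ∨ f = ![i, c] ∨ f = ![i + 1, c]})

/-- LOCAL ONE-SIDED form of the cut predicate. [folklore] -/
def cmkCutLoc (i c : ℤ) (x : Obs) : Prop :=
  cmkPattern i c x ∧ ((![i, c], ![i + 2, c]) : Site 2 × Site 2) ∉ cmkLoR i c x ∧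
    ((![i, c - 2], ![i + 1, c]) : Site 2 × Site 2) ∈ cmkLoR i c x ∧
    ((![i, c], ![i + 2, c]) : Site 2 × Site 2) ∉ cmkUpR i c (cmkFlat i c x) ∧
    ((![i + 1, c], ![i, c + 2]) : Site 2 × Site 2) ∈ cmkUpR i c (cmkFlat i c x)

/-- The upper half-diagram WITH PIVOT: pairs of (boundary or pivot) cells joined inside the rows `≥ c`. [folklore] -/
def cmkUpDp (i c : ℤ) (x : Obs) : Set (Site 2 × Site 2) := {pq | cmkBdp i c pq.1 ∧ cmkBdp i c pq.2 ∧ pq ∈ cmkUpR i c x}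

/-- ASSEMBLY of a diagram from lower reachability `L` and upper half-diagram `U`. [folklore] -/
def cmkComb (i c : ℤ) (L U : Set (Site 2 × Site 2)) : Set (Site 2 × Site 2) :=
  {pq | cmkBd i pq.1 ∧ cmkBd i pq.2 ∧
    ((pq.1 1 ≤ c ∧ pq.2 1 ≤ c ∧ pq ∈ L) ∨ (c ≤ pq.1 1 ∧ c ≤ pq.2 1 ∧ pq ∈ U) ∨
     (∃ X : Site 2, X 1 = c ∧ (pq.1, X) ∈ L ∧ (X, pq.2) ∈ U) ∨ (∃ X : Site 2, X 1 = c ∧ (pq.1, X) ∈ U ∧ (X, pq.2) ∈ L))}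

/-- READING the upper half-diagram with pivot off a diagram. [folklore] -/
def cmkPi2 (i c : ℤ) (D : Set (Site 2 × Site 2)) : Set (Site 2 × Site 2) :=
  {pq | (cmkBd i pq.1 ∧ cmkBd i pq.2 ∧ c ≤ pq.1 1 ∧ c ≤ pq.2 1 ∧ pq ∈ D) ∨
    (pq.1 = ![i + 1, c] ∧ cmkBd i pq.2 ∧ c ≤ pq.2 1 ∧ ((![i, c - 2] : Site 2), pq.2) ∈ D) ∨
    (cmkBd i pq.1 ∧ c ≤ pq.1 1 ∧ pq.2 = ![i + 1, c] ∧ ((![i, c - 2] : Site 2), pq.1) ∈ D) ∨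
    (pq.1 = ![i + 1, c] ∧ pq.2 = ![i + 1, c])}

/-! ## Small facts -/

/-- The three strip cells of row `c`. [folklore] -/
theorem cmk_rowc_cases {i c : ℤ} {X : Site 2} (h0 : i ≤ X 0) (h0' : X 0 ≤ i + 2) (h1 : X 1 = c) :
    X = ![i, c] ∨ X = ![i + 1, c] ∨ X = ![i + 2, c] := by
  have hX : X = ![X 0, X 1] := (SDE.site2_eta X).symm
  rcases (show X 0 = i ∨ X 0 = i + 1 ∨ X 0 = i + 2 by omega) with e | e | e
  · left; rw [hX, e, h1]
  · right; left; rw [hX, e, h1]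
  · right; right; rw [hX, e, h1]

/-- A row-`c` strip cell is a boundary cell or the pivot. [folklore] -/
theorem cmk_bdp_of_rowc {i c : ℤ} {X : Site 2} (h0 : i ≤ X 0) (h0' : X 0 ≤ i + 2) (h1 : X 1 = c) : cmkBdp i c X := by
  rcases cmk_rowc_cases h0 h0' h1 with rfl | rfl | rfl
  · exact Or.inl (Or.inl (by simp))
  · exact Or.inr rfl
  · exact Or.inl (Or.inr (by simp))

/-- The cut predicate read on the configuration. [folklore] -/
theorem cmk_isCut_iff_pattern (i c : ℤ) (x : Obs) : IsCut i c (pinnedStat i x) ↔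
    cmkPattern i c x ∧ ((![i, c], ![i + 2, c]) : Site 2 × Site 2) ∉ stripDiagram i x ∧
      ((![i, c - 2], ![i, c + 2]) : Site 2 × Site 2) ∈ stripDiagram i x := by
  have hi : (i : ℤ) ≠ i + 1 := by omega
  have hi2 : (i + 2 : ℤ) ≠ i + 1 := by omega
  simp only [IsCut, cmkPattern, pinnedStat, crk_mem_eraseMid_fst i x _ _ hi, crk_mem_eraseMid_fst i x _ _ hi2]
  tauto

/-- Row steps of the restricted triangulation. [folklore] -/
theorem cmk_within_rows (A s : Set (Site 2)) : ∀ u v : Site 2, (SDE.within (cellGraph A) s).Adj u v →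
    v 1 ≤ u 1 + 1 ∧ u 1 ≤ v 1 + 1 := fun _ _ h => ⟨(crk_adj_near h.1).1, (crk_adj_near h.1).2.1⟩

/-- The colour classes of `cmkFlat i c x` are those of `x`. [folklore] -/
theorem cmk_cls_flat (i c : ℤ) (x : Obs) (p : Site 2) : SDE.cls (cmkFlat i c x) i p = SDE.cls x i p := rfl

/-! ## Bichromatic row-`c` faces: the flags of row `c` do not matter -/

/-- If the boundary pattern holds and the middle cells of rows `c, c+1` carry the opposite colour, setting the
row-`c` flags does not change upper half-strip reachability. [folklore] -/
theorem cmk_UpR_flat {i c : ℤ} {x : Obs} (hpat : cmkPattern i c x)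
    (hm0 : (![i + 1, c] : Site 2) ∈ x.1 ↔ (![i, c] : Site 2) ∉ x.1)
    (hm1 : (![i + 1, c + 1] : Site 2) ∈ x.1 ↔ (![i, c] : Site 2) ∉ x.1) : cmkUpR i c (cmkFlat i c x) = cmkUpR i c x := by
  obtain ⟨hbd, -, -⟩ := hpat
  have hL0 := (hbd c (by omega) (by omega)).1
  have hL1 := (hbd (c + 1) (by omega) (by omega)).1
  have hR0 := (hbd c (by omega) (by omega)).2
  have hR1 := (hbd (c + 1) (by omega) (by omega)).2
  ext ⟨p, q⟩
  rw [cmk_mem_UpR_iff, cmk_mem_UpR_iff, cmk_cls_flat]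
  have key : ∀ u v : Site 2, (SDE.within (cellGraph (cmkFlat i c x).2) (SDE.cls x i p ∩ {v | c ≤ v 1})).Reachable u v ↔
      (SDE.within (cellGraph x.2) (SDE.cls x i p ∩ {v | c ≤ v 1})).Reachable u v := by
    refine cmk_reach_congr_of_bichromatic fun a b => ?_
    by_cases hab : (a = i ∧ b = c) ∨ (a = i + 1 ∧ b = c)
    · right
      -- both diagonals of the two row-`c` faces are bichromatic
      have clash : ∀ {P Q : Site 2}, (P ∈ x.1 ↔ (![i, c] : Site 2) ∈ x.1) → (Q ∈ x.1 ↔ (![i, c] : Site 2) ∉ x.1) →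
          ¬ (P ∈ SDE.cls x i p ∩ {v | c ≤ v 1} ∧ Q ∈ SDE.cls x i p ∩ {v | c ≤ v 1}) := by
        rintro P Q hP hQ ⟨⟨⟨hP', -⟩, -⟩, ⟨⟨hQ', -⟩, -⟩⟩
        exact iff_not_self ((hP.symm.trans (hP'.trans hQ'.symm)).trans hQ)
      have clash' : ∀ {P Q : Site 2}, (P ∈ x.1 ↔ (![i, c] : Site 2) ∉ x.1) → (Q ∈ x.1 ↔ (![i, c] : Site 2) ∈ x.1) →
          ¬ (P ∈ SDE.cls x i p ∩ {v | c ≤ v 1} ∧ Q ∈ SDE.cls x i p ∩ {v | c ≤ v 1}) :=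
        fun hP hQ h => clash hQ hP ⟨h.2, h.1⟩
      rcases hab with ⟨ha, hb⟩ | ⟨ha, hb⟩
      · rw [ha, hb]; exact ⟨clash hL0 hm1, clash hL1 hm0⟩
      · rw [ha, hb, show (i + 1 + 1 : ℤ) = i + 2 by ring]; exact ⟨clash' hm0 hR1, clash' hm1 hR0⟩
    · left
      simp only [cmkFlat, mem_setOf_eq, SquareTiling.vec2_eq_iff]
      tauto
  rw [key]

/-! ## Rerouting consequences of a cut row -/

section Cut

variable {i c : ℤ} {x : Obs}

/-- At a cut row, setting the row-`c` flags does not change upper half-strip reachability. [folklore] -/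
theorem cmk_isCut_UpR_flat (h : IsCut i c (pinnedStat i x)) : cmkUpR i c (cmkFlat i c x) = cmkUpR i c x :=
  cmk_UpR_flat ((cmk_isCut_iff_pattern i c x).1 h).1 (isCut_forces_mid i c x h c (by omega) (by omega))
    (isCut_forces_mid i c x h (c + 1) (by omega) (by omega))

/-- At a cut row, two boundary cells of rows `≥ c` are joined in the strip iff inside the upper half-strip. [folklore] -/
theorem cmk_isCut_upper (h : IsCut i c (pinnedStat i x)) {P Q : Site 2} (hP : cmkBd i P) (hQ : cmkBd i Q)
    (hPc : c ≤ P 1) (hQc : c ≤ Q 1) : (P, Q) ∈ stripDiagram i x ↔ (P, Q) ∈ cmkUpR i c x := by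
  rw [SDE.mem_stripDiagram_iff, cmk_mem_UpR_iff]
  constructor
  · rintro ⟨-, -, hq, hp, hr⟩
    exact ⟨⟨hq, hQc⟩, ⟨hp, hPc⟩, ((isCut_reroute i c x h (P ∈ x.1) P Q hp hq hr).1 hPc hQc)⟩
  · rintro ⟨⟨hq, -⟩, ⟨hp, -⟩, hr⟩
    exact ⟨hP, hQ, hq, hp, SDE.within_mono _ inter_subset_left hr⟩

/-- At a cut row, two boundary cells of rows `≤ c` are joined in the strip iff inside the lower half-strip. [folklore] -/
theorem cmk_isCut_lower (h : IsCut i c (pinnedStat i x)) {P Q : Site 2} (hP : cmkBd i P) (hQ : cmkBd i Q)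
    (hPc : P 1 ≤ c) (hQc : Q 1 ≤ c) : (P, Q) ∈ stripDiagram i x ↔ (P, Q) ∈ cmkLoR i c x := by
  rw [SDE.mem_stripDiagram_iff, cmk_mem_LoR_iff]
  constructor
  · rintro ⟨-, -, hq, hp, hr⟩
    exact ⟨⟨hq, hQc⟩, ⟨hp, hPc⟩, ((isCut_reroute i c x h (P ∈ x.1) P Q hp hq hr).2 hPc hQc)⟩
  · rintro ⟨⟨hq, -⟩, ⟨hp, -⟩, hr⟩
    exact ⟨hP, hQ, hq, hp, SDE.within_mono _ inter_subset_left hr⟩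

/-- A row-`c` cell of the colour of `(i, c-2)` is the pivot, under the boundary pattern. [folklore] -/
theorem cmk_rowc_eq_piv (hpat : cmkPattern i c x) {w : Site 2} (hw : w ∈ SDE.cls x i ![i, c - 2]) (hw1 : w 1 = c) :
    w = ![i + 1, c] := by
  obtain ⟨hbd, hm2, -⟩ := hpat
  rcases cmk_rowc_cases hw.2.1 hw.2.2 hw1 with rfl | rfl | rfl
  · exact absurd (hw.1.trans hm2) iff_not_self
  · rfl
  · exact absurd ((hbd c (by omega) (by omega)).2.symm.trans (hw.1.trans hm2)) iff_not_self

/-- At a cut row the pivot is joined to `(i, c-2)` below and to `(i, c+2)` above. [folklore] -/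
theorem cmk_isCut_piv (h : IsCut i c (pinnedStat i x)) :
    ((![i, c - 2], ![i + 1, c]) : Site 2 × Site 2) ∈ cmkLoR i c x ∧
      ((![i + 1, c], ![i, c + 2]) : Site 2 × Site 2) ∈ cmkUpR i c x := by
  obtain ⟨hpat, -, hpair⟩ := (cmk_isCut_iff_pattern i c x).1 h
  rw [SDE.mem_stripDiagram_iff] at hpair
  obtain ⟨-, -, hq, hp, hr⟩ := hpair
  obtain ⟨w, hw1, hw2, hw3⟩ := cmk_exists_row_split _ (fun v : Site 2 => v 1) (fun u v huv => (cmk_within_rows _ _ u v huv).1)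
    hr c (by simp) (by simp)
  have hw : w ∈ SDE.cls x i ![i, c - 2] := SDE.within_reachable_mem _ _ hw1 hp
  have hwp : w = ![i + 1, c] := cmk_rowc_eq_piv hpat hw hw3
  subst hwp
  have e := cmk_cls_eq_of_mem hw
  refine ⟨?_, ?_⟩
  · rw [cmk_mem_LoR_iff]
    exact ⟨⟨hw, by simp⟩, ⟨hp, by simp⟩, (isCut_reroute i c x h _ _ _ hp hw hw1).2 (by simp) (by simp)⟩
  · rw [cmk_mem_UpR_iff, e]
    exact ⟨⟨hq, by simp⟩, ⟨hw, by simp⟩, (isCut_reroute i c x h _ _ _ hw hq hw2).1 (by simp) (by simp)⟩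

/-- `IsCut ⟹ cmkCutLoc`. [folklore] -/
theorem cmk_isCut_imp_cutLoc (h : IsCut i c (pinnedStat i x)) : cmkCutLoc i c x := by
  obtain ⟨hpat, hnot, -⟩ := (cmk_isCut_iff_pattern i c x).1 h
  obtain ⟨hplo, hpup⟩ := cmk_isCut_piv h
  have hb0 : cmkBd i ![i, c] := Or.inl (by simp)
  have hb2 : cmkBd i ![i + 2, c] := Or.inr (by simp)
  refine ⟨hpat, fun hL => hnot ((cmk_isCut_lower h hb0 hb2 (by simp) (by simp)).2 hL), hplo, ?_, ?_⟩
  · rw [cmk_isCut_UpR_flat h]; exact fun hU => hnot ((cmk_isCut_upper h hb0 hb2 (by simp) (by simp)).2 hU)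
  · rw [cmk_isCut_UpR_flat h]; exact hpup

end Cut

/-! ## The converse: from the local one-sided conditions to the cut -/

/-- FIRST STEP OF THE UPPER PIVOT PATH on `cmkFlat`: it goes to `(i+1, c+1)`, which therefore carries the
pivot's colour. [folklore] -/
theorem cmk_flat_forces_up {i c : ℤ} {x : Obs} (hpat : cmkPattern i c x)
    (hm0 : (![i + 1, c] : Site 2) ∈ x.1 ↔ (![i, c] : Site 2) ∉ x.1)
    (hup : ((![i + 1, c], ![i, c + 2]) : Site 2 × Site 2) ∈ cmkUpR i c (cmkFlat i c x)) :
    (![i + 1, c + 1] : Site 2) ∈ x.1 ↔ (![i, c] : Site 2) ∉ x.1 := by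
  obtain ⟨hbd, -, -⟩ := hpat
  rw [cmk_mem_UpR_iff, cmk_cls_flat] at hup
  obtain ⟨-, -, hr⟩ := hup
  rcases ((SimpleGraph.reachable_iff_reflTransGen _ _).1 hr).cases_head with heq | ⟨n, hadj, -⟩
  · exfalso; have := congrFun heq 0; simp at this
  obtain ⟨hadj, -, ⟨hn, hnc⟩⟩ := hadj
  -- colour bookkeeping: `n` has the pivot's colour `¬col`
  have hncol : n ∈ x.1 ↔ (![i, c] : Site 2) ∉ x.1 := hn.1.trans hm0
  have hn_eq : n = ![n 0, n 1] := (SDE.site2_eta n).symm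
  have clash : ∀ {P : Site 2}, n = P → (P ∈ x.1 ↔ (![i, c] : Site 2) ∈ x.1) → False := by
    rintro P rfl hP; exact iff_not_self (hP.symm.trans hncol)
  rw [SDE.cellGraph_adj_iff, SDE.grid_adj] at hadj
  have hflag : (![i + 1, c] : Site 2) ∈ (cmkFlat i c x).2 := by simp [cmkFlat]
  simp only [Matrix.cons_val_zero, Matrix.cons_val_one] at hadj
  change c ≤ n 1 at hnc
  rcases hadj with (⟨h1, h2⟩ | ⟨h1, h2⟩ | ⟨h1, h2, h3⟩ | ⟨h1, h2, -⟩) | (⟨h1, h2⟩ | ⟨h1, h2⟩ | ⟨h1, h2, -⟩ | ⟨h1, h2, -⟩)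
  · exact (clash (P := ![i + 2, c]) (by rw [SDE.site2_eq_iff]; simp; omega) (hbd c (by omega) (by omega)).2).elim
  · rw [hn_eq, h1, h2] at hncol; exact hncol
  · exact (h3 hflag).elim
  · exfalso; omega
  · exact (clash (P := ![i, c]) (by rw [SDE.site2_eq_iff]; simp; omega) Iff.rfl).elim
  · exfalso; omega
  · exfalso; omega
  · exact (clash (P := ![i, c + 1]) (by rw [SDE.site2_eq_iff]; simp; omega) (hbd (c + 1) (by omega) (by omega)).1).elim

/-- `cmkCutLoc ⟹ IsCut` (pattern, concatenation through the pivot, and the excursion lemma). [folklore] -/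
theorem cmk_cutLoc_imp_isCut {i c : ℤ} {x : Obs} (h : cmkCutLoc i c x) : IsCut i c (pinnedStat i x) := by
  obtain ⟨hpat, hnL, hplo, hnU, hpup⟩ := h
  -- the pivot carries `¬col`, then so does `(i+1, c+1)`, so the row-`c` flags do not matter
  have hpiv : (![i + 1, c] : Site 2) ∈ SDE.cls x i ![i, c - 2] := ((cmk_mem_LoR_iff _ _ _ _ _).1 hplo).1.1
  have hm0 : (![i + 1, c] : Site 2) ∈ x.1 ↔ (![i, c] : Site 2) ∉ x.1 := hpiv.1.trans hpat.2.1
  have hm1 := cmk_flat_forces_up hpat hm0 hpup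
  rw [cmk_UpR_flat hpat hm0 hm1] at hnU hpup
  rw [cmk_isCut_iff_pattern]
  have e := cmk_cls_eq_of_mem hpiv
  refine ⟨hpat, fun hD => ?_, ?_⟩
  · -- `(i,c) ≁ (i+2,c)`: an excursion would join them on one side
    rw [SDE.mem_stripDiagram_iff] at hD
    obtain ⟨-, -, -, -, hr⟩ := hD
    have hne : (![i, c] : Site 2) ≠ ![i + 2, c] := by rw [Ne, SquareTiling.vec2_eq_iff]; omega
    obtain ⟨Z, hZs, hZc, hZne, hZ⟩ := cmk_excursion (cellGraph x.2) (fun v : Site 2 => v 1)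
      (fun u v huv => ⟨(crk_adj_near huv).1, (crk_adj_near huv).2.1⟩) (SDE.cls x i ![i, c]) c ![i, c] ![i + 2, c]
      (by simp) (by simp) hne hr
    have hZ2 : Z = ![i + 2, c] := by
      rcases cmk_rowc_cases hZs.2.1 hZs.2.2 hZc with rfl | rfl | rfl
      · exact absurd rfl hZne
      · exact absurd (hZs.1.symm.trans hm0) iff_not_self
      · rfl
    subst hZ2
    rcases hZ with hZ | hZ
    · exact hnU ((cmk_mem_UpR_iff _ _ _ _ _).2 ⟨⟨hZs, by simp⟩, ⟨⟨Iff.rfl, by simp, by simp⟩, by simp⟩, hZ⟩)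
    · exact hnL ((cmk_mem_LoR_iff _ _ _ _ _).2 ⟨⟨hZs, by simp⟩, ⟨⟨Iff.rfl, by simp, by simp⟩, by simp⟩, hZ⟩)
  · -- `(i,c-2) ∼ (i,c+2)` through the pivot
    obtain ⟨-, ⟨hp, -⟩, hr1⟩ := (cmk_mem_LoR_iff _ _ _ _ _).1 hplo
    obtain ⟨⟨hq, -⟩, -, hr2⟩ := (cmk_mem_UpR_iff _ _ _ _ _).1 hpup
    rw [e] at hq hr2
    exact cmk_mem_stripDiagram_of_within (Or.inl (by simp)) (Or.inl (by simp)) hq subset_rfl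
      ((SDE.within_mono _ inter_subset_left hr1).trans (SDE.within_mono _ inter_subset_left hr2))

/-- THE CUT PREDICATE IN LOCAL ONE-SIDED FORM. [folklore] -/
theorem cmk_isCut_iff_cutLoc (i c : ℤ) (x : Obs) : IsCut i c (pinnedStat i x) ↔ cmkCutLoc i c x :=
  ⟨cmk_isCut_imp_cutLoc, cmk_cutLoc_imp_isCut⟩

/-! ## The factorisation of the strip diagram -/

/-- THE STRIP DIAGRAM AT A CUT ROW IS ASSEMBLED FROM THE TWO HALF-STRIPS (registered sub-goal
`cmk_stripDiagram_eq_comb`). [folklore] -/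
theorem cmk_stripDiagram_eq_comb : ∀ (i c : ℤ) (x : Obs), IsCut i c (pinnedStat i x) →
    stripDiagram i x = cmkComb i c (cmkLoR i c x) (cmkUpDp i c x) := by
  intro i c x h
  ext ⟨P, Q⟩
  simp only [cmkComb, mem_setOf_eq]
  constructor
  · intro hD
    have hD' := hD
    rw [SDE.mem_stripDiagram_iff] at hD'
    obtain ⟨hP0, hQ0, hq, hp, hr⟩ := hD'
    refine ⟨hP0, hQ0, ?_⟩
    by_cases h1 : P 1 ≤ c <;> by_cases h2 : Q 1 ≤ c
    · exact Or.inl ⟨h1, h2, (cmk_isCut_lower h hP0 hQ0 h1 h2).1 hD⟩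
    · -- ascending straddle: split at row `c`
      obtain ⟨X, hX1, hX2, hX3⟩ := cmk_exists_row_split _ (fun v : Site 2 => v 1)
        (fun u v huv => (cmk_within_rows _ _ u v huv).1) hr c h1 (by omega)
      have hX : X ∈ SDE.cls x i P := SDE.within_reachable_mem _ _ hX1 hp
      have e := cmk_cls_eq_of_mem hX
      refine Or.inr (Or.inr (Or.inl ⟨X, hX3, ?_, cmk_bdp_of_rowc hX.2.1 hX.2.2 hX3, Or.inl hQ0, ?_⟩))
      · rw [cmk_mem_LoR_iff]
        exact ⟨⟨hX, hX3.le⟩, ⟨hp, h1⟩, (isCut_reroute i c x h _ _ _ hp hX hX1).2 h1 hX3.le⟩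
      · rw [cmk_mem_UpR_iff, e]
        exact ⟨⟨hq, by omega⟩, ⟨hX, hX3.ge⟩, (isCut_reroute i c x h _ _ _ hX hq hX2).1 hX3.ge (by omega)⟩
    · -- descending straddle
      obtain ⟨X, hX1, hX2, hX3⟩ := cmk_exists_row_split' _ (fun v : Site 2 => v 1)
        (fun u v huv => (cmk_within_rows _ _ u v huv).2) hr c (by omega) h2
      have hX : X ∈ SDE.cls x i P := SDE.within_reachable_mem _ _ hX1 hp
      have e := cmk_cls_eq_of_mem hX
      refine Or.inr (Or.inr (Or.inr ⟨X, hX3, ⟨Or.inl hP0, cmk_bdp_of_rowc hX.2.1 hX.2.2 hX3, ?_⟩, ?_⟩))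
      · rw [cmk_mem_UpR_iff]
        exact ⟨⟨hX, hX3.ge⟩, ⟨hp, by omega⟩, (isCut_reroute i c x h _ _ _ hp hX hX1).1 (by omega) hX3.ge⟩
      · rw [cmk_mem_LoR_iff, e]
        exact ⟨⟨hq, h2⟩, ⟨hX, hX3.le⟩, (isCut_reroute i c x h _ _ _ hX hq hX2).2 hX3.le h2⟩
    · exact Or.inr (Or.inl ⟨by omega, by omega, Or.inl hP0, Or.inl hQ0, (cmk_isCut_upper h hP0 hQ0 (by omega) (by omega)).1 hD⟩)
  · rintro ⟨hP0, hQ0, ⟨-, -, hL⟩ | ⟨-, -, -, -, hU⟩ | ⟨X, -, hL, -, -, hU⟩ | ⟨X, -, ⟨-, -, hU⟩, hL⟩⟩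
    · obtain ⟨⟨hq, -⟩, -, hr⟩ := (cmk_mem_LoR_iff _ _ _ _ _).1 hL
      exact cmk_mem_stripDiagram_of_within hP0 hQ0 hq inter_subset_left hr
    · obtain ⟨⟨hq, -⟩, -, hr⟩ := (cmk_mem_UpR_iff _ _ _ _ _).1 hU
      exact cmk_mem_stripDiagram_of_within hP0 hQ0 hq inter_subset_left hr
    · obtain ⟨⟨hX, -⟩, -, hr1⟩ := (cmk_mem_LoR_iff _ _ _ _ _).1 hL
      obtain ⟨⟨hq, -⟩, -, hr2⟩ := (cmk_mem_UpR_iff _ _ _ _ _).1 hU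
      rw [cmk_cls_eq_of_mem hX] at hq hr2
      exact cmk_mem_stripDiagram_of_within hP0 hQ0 hq subset_rfl
        ((SDE.within_mono _ inter_subset_left hr1).trans (SDE.within_mono _ inter_subset_left hr2))
    · obtain ⟨⟨hX, -⟩, -, hr1⟩ := (cmk_mem_UpR_iff _ _ _ _ _).1 hU
      obtain ⟨⟨hq, -⟩, -, hr2⟩ := (cmk_mem_LoR_iff _ _ _ _ _).1 hL
      rw [cmk_cls_eq_of_mem hX] at hq hr2
      exact cmk_mem_stripDiagram_of_within hP0 hQ0 hq subset_rfl
        ((SDE.within_mono _ inter_subset_left hr1).trans (SDE.within_mono _ inter_subset_left hr2))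

/-- At a cut row, the pivot is joined above to a boundary cell `Q` iff `((i, c-2), Q)` is in the strip diagram. [folklore] -/
theorem cmk_isCut_pivQ {i c : ℤ} {x : Obs} (h : IsCut i c (pinnedStat i x)) {Q : Site 2} (hQ : cmkBd i Q) :
    ((![i + 1, c] : Site 2), Q) ∈ cmkUpR i c x ↔ c ≤ Q 1 ∧ ((![i, c - 2] : Site 2), Q) ∈ stripDiagram i x := by
  obtain ⟨hpat, -, -⟩ := (cmk_isCut_iff_pattern i c x).1 h
  obtain ⟨hplo, -⟩ := cmk_isCut_piv h
  obtain ⟨⟨hpiv, -⟩, ⟨hp, -⟩, hr1⟩ := (cmk_mem_LoR_iff _ _ _ _ _).1 hplo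
  have e := cmk_cls_eq_of_mem hpiv
  constructor
  · intro hU
    obtain ⟨⟨hq, hqc⟩, -, hr2⟩ := (cmk_mem_UpR_iff _ _ _ _ _).1 hU
    rw [e] at hq hr2
    exact ⟨hqc, cmk_mem_stripDiagram_of_within (Or.inl (by simp)) hQ hq subset_rfl
      ((SDE.within_mono _ inter_subset_left hr1).trans (SDE.within_mono _ inter_subset_left hr2))⟩
  · rintro ⟨hqc, hD⟩
    rw [SDE.mem_stripDiagram_iff] at hD
    obtain ⟨-, -, hq, -, hr⟩ := hD
    obtain ⟨w, hw1, hw2, hw3⟩ := cmk_exists_row_split _ (fun v : Site 2 => v 1)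
      (fun u v huv => (cmk_within_rows _ _ u v huv).1) hr c (by simp) hqc
    have hw : w ∈ SDE.cls x i ![i, c - 2] := SDE.within_reachable_mem _ _ hw1 hp
    have hwp : w = ![i + 1, c] := cmk_rowc_eq_piv hpat hw hw3
    subst hwp
    rw [cmk_mem_UpR_iff, e]
    exact ⟨⟨hq, hqc⟩, ⟨hw, by simp⟩, (isCut_reroute i c x h _ _ _ hw hq hw2).1 (by simp) hqc⟩

/-- THE UPPER HALF-DIAGRAM WITH PIVOT IS READ OFF THE STRIP DIAGRAM at a cut row. [folklore] -/
theorem cmk_pi2_stripDiagram {i c : ℤ} {x : Obs} (h : IsCut i c (pinnedStat i x)) :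
    cmkPi2 i c (stripDiagram i x) = cmkUpDp i c x := by
  have hpb : ¬ cmkBd i (![i + 1, c] : Site 2) := by rintro (h' | h') <;> simp at h'
  have hrefl : ((![i + 1, c], ![i + 1, c]) : Site 2 × Site 2) ∈ cmkUpR i c x :=
    (cmk_mem_UpR_iff _ _ _ _ _).2 ⟨⟨⟨Iff.rfl, by simp, by simp⟩, by simp⟩, ⟨⟨Iff.rfl, by simp, by simp⟩, by simp⟩,
      SimpleGraph.Reachable.refl _⟩
  ext ⟨P, Q⟩
  constructor
  · rintro (⟨hbP, hbQ, hP1, hQ1, hD⟩ | ⟨hP, hbQ, hQ1, hD⟩ | ⟨hbP, hP1, hQ, hD⟩ | ⟨hP, hQ⟩)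
    · exact ⟨Or.inl hbP, Or.inl hbQ, (cmk_isCut_upper h hbP hbQ hP1 hQ1).1 hD⟩
    · simp only at hP; subst hP
      exact ⟨Or.inr rfl, Or.inl hbQ, (cmk_isCut_pivQ h hbQ).2 ⟨hQ1, hD⟩⟩
    · simp only at hQ; subst hQ
      exact ⟨Or.inl hbP, Or.inr rfl, cmk_UpR_symm ((cmk_isCut_pivQ h hbP).2 ⟨hP1, hD⟩)⟩
    · simp only at hP hQ; subst hP; subst hQ
      exact ⟨Or.inr rfl, Or.inr rfl, hrefl⟩
  · rintro ⟨hbP | hP, hbQ | hQ, hU⟩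
    · obtain ⟨⟨-, hQ1⟩, ⟨-, hP1⟩, -⟩ := (cmk_mem_UpR_iff _ _ _ _ _).1 hU
      exact Or.inl ⟨hbP, hbQ, hP1, hQ1, (cmk_isCut_upper h hbP hbQ hP1 hQ1).2 hU⟩
    · simp only at hQ; subst hQ
      exact Or.inr (Or.inr (Or.inl ⟨hbP, ((cmk_isCut_pivQ h hbP).1 (cmk_UpR_symm hU)).1, rfl,
        ((cmk_isCut_pivQ h hbP).1 (cmk_UpR_symm hU)).2⟩))
    · simp only at hP; subst hP
      exact Or.inr (Or.inl ⟨rfl, hbQ, (cmk_isCut_pivQ h hbQ).1 hU⟩)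
    · simp only at hP hQ; subst hP; subst hQ
      exact Or.inr (Or.inr (Or.inr ⟨rfl, rfl⟩))

end Summit.CriticalPhenomena.CardyFormulaZ2.Theorems.IKLinearTransport.PinnedDiagramExchange
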